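import Summits.QuantumFields.YangMills.Theorems.FemtoCurvatureTwoPoint.Negative.FiniteGroupTwoPlaquettes
import Literature.MathematicalPhysics.QuantumFieldTheory.AbelianHiggsTorusClustering
import Literature.MathematicalPhysics.QuantumFieldTheory.LatticeGaugeDobrushinPoincare
import Literature.MathematicalPhysics.QuantumFieldTheory.Sweep1AreaLawProofs

/-!
# `FemtoCurvatureTwoPoint` — plaquette expectations of a finite abelian lattice gauge theory on
# `(ℤ/8)⁴`: the axis pair is `O(ε⁸)`, the shared-link pair is `Ω(ε⁶)` (support file for
# `Negative.FiniteGroupFalse`)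

Negative-side support for crux `Summit.QuantumFields.YangMills.Theses.LangevinControlUV.
FemtoCurvatureTwoPoint` (item stmt-QuantumFields-9363; cdisprove gen 1), sequel of
`Negative.FiniteGroupTwoPlaquettes`. For a finite abelian gauge group `G` with a unitary
representation `ρ` having action gap `δ` (`δ ≤ N - Re tr ρ(g)` for `g ≠ 1`), Wilson weights
`φ_β(a) = e^{-β(N - Re tr ρ(a))} ≤ ε = e^{-βδ}` off `0`, plaquette field `P(a) = N - Re tr ρ(a)`,
on the torus `(ℤ/8)⁴`, in the EXACT (= link) vortex ensemble `Img`: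

* `sum_Img_axis_le` — `∑_{η exact} Wt(η) P(η p₀) P(η p₁) ≤ 4N² Z_closed (δ(λ,8) + δ(λ,5)²)`
  (`p₀ = (0;0,1)`, `p₁ = (e₂;0,1)`, `λ = |G| ε`; two-vortex Peierls bound);
* `sum_Img_q0_le`, `sum_Img_p1_le` — `∑_{η exact} Wt(η) P(η q) ≤ 2N Z_closed δ(λ,5)` for
  `q ∈ {q₀ = (0;0,2), p₁}` (a vortex through `q` has `≥ 5` plaquettes);
* `sum_Img_pair_ge` — `∑_{η exact} Wt(η) P(η q₀) P(η p₁) ≥ (N - Re tr ρ(g₀))² e^{-6β(N - Re tr ρ(g₀))}`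
  for every `g₀` (the single-link excitation `U = 1[ℓ ↦ g₀]`, `ℓ = (e₂, 0)`, shared by `q₀` and
  `p₁`: its plaquette field is supported on the `6` plaquettes through `ℓ`).
-/

noncomputable section

open Finset Function
open Literature.MathematicalPhysics.QuantumFieldTheory
open Literature.MathematicalPhysics.QuantumFieldTheory.LatticeForm
open Literature.Probability.LatticeModels (IsRConnected rcomponent rcomponents mem_rcomponent
  rcomponent_subset mem_rcomponent_self rcomponent_eq_of_mem isRConnected_rcomponent
  mem_rcomponents_iff)
open Summit.QuantumFields.YangMills.Theorems.FemtoCurvatureTwoPoint.Negative.FiniteGroupPeierls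
open Summit.QuantumFields.YangMills.Theorems.FemtoCurvatureTwoPoint.Negative.FiniteGroupVortices
open Summit.QuantumFields.YangMills.Theorems.FemtoCurvatureTwoPoint.Negative.FiniteGroupTwoPlaquettes

namespace Summit.QuantumFields.YangMills.Theorems.FemtoCurvatureTwoPoint.Negative.FiniteGroupBounds

/-! ### Generic facts (any torus) -/

section Generic

variable {d L N : ℕ} [NeZero L] {G : Type*} [CommGroup G] [Fintype G] [DecidableEq G]
  (ρ : G →* Matrix (Fin N) (Fin N) ℂ)

omit [Fintype G] [DecidableEq G] [NeZero L] in
/-- The plaquette field value `P(g) = N - Re tr ρ(g)` lies in `[0, 2N]` (unitary `ρ`). -/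
theorem gap_mem (hρu : ∀ g, ρ g ∈ Matrix.unitaryGroup (Fin N) ℂ) (g : G) :
    0 ≤ (N : ℝ) - (ρ g).trace.re ∧ (N : ℝ) - (ρ g).trace.re ≤ 2 * N := by
  have h := abs_le.1 (abs_re_trace_le_of_mem_unitaryGroup (hρu g))
  constructor <;> linarith

omit [Fintype G] [DecidableEq G] [NeZero L] in
/-- `P(1) = 0`. -/
theorem gap_one : (N : ℝ) - (ρ (1 : G)).trace.re = 0 := by
  simp [Matrix.trace_one]

/-- Exact configurations: the plaquette field of a link configuration. -/
theorem plaqField_mem_Img (U : GaugeConfig d L G) : plaqField U ∈ Img d L G :=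
  Finset.mem_image.2 ⟨U, Finset.mem_univ _, rfl⟩

/-- A weighted exact-ensemble sum of an observable dominated by `M` times an indicator is at most
`M` times the CLOSED weight of the indicated configurations. -/
theorem sum_Img_le_of_le_indicator {φ : Additive G → ℝ} (hφ : ∀ a, 0 ≤ φ a)
    {f : (Plaquette d L → Additive G) → ℝ} {M : ℝ} (hM : 0 ≤ M) (P : (Plaquette d L → Additive G) → Prop)
    [DecidablePred P] (hfP : ∀ η, f η ≤ if P η then M else 0) :
    ∑ η ∈ Img d L G, Wt φ η * f η ≤ M * ∑ η ∈ (Closed d L (Additive G)).filter P, Wt φ η := by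
  calc ∑ η ∈ Img d L G, Wt φ η * f η ≤ ∑ η ∈ Img d L G, Wt φ η * (if P η then M else 0) :=
        Finset.sum_le_sum fun η _ => mul_le_mul_of_nonneg_left (hfP η) (Wt_nonneg hφ η)
    _ = ∑ η ∈ (Img d L G).filter P, Wt φ η * M := by
        rw [Finset.sum_filter]
        refine Finset.sum_congr rfl fun η _ => ?_
        split_ifs <;> simp
    _ ≤ ∑ η ∈ (Closed d L (Additive G)).filter P, Wt φ η * M :=
        Finset.sum_le_sum_of_subset_of_nonneg (Finset.filter_subset_filter _ Img_subset_Closed)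
          fun η _ _ => mul_nonneg (Wt_nonneg hφ η) hM
    _ = M * ∑ η ∈ (Closed d L (Additive G)).filter P, Wt φ η := by
        rw [Finset.mul_sum]; exact Finset.sum_congr rfl fun η _ => mul_comm _ _

end Generic

/-! ### The torus `(ℤ/8)⁴` -/

section L8

/- At the concrete torus `L = 8` the unifier must never unfold the finsets over all plaquettes /
configurations. -/
attribute [local irreducible] psupp Closed Fib connSets Wt Img

variable {N : ℕ} {G : Type*} [CommGroup G] [Fintype G] [DecidableEq G]
  (ρ : G →* Matrix (Fin N) (Fin N) ℂ)

/-- **Axis pair, upper bound**: `∑_{η exact} Wt(η) P(η p₀) P(η p₁) ≤ 4N² Z_closed (δ(λ,8) + δ(λ,5)²)`. -/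
theorem sum_Img_axis_le (hρu : ∀ g, ρ g ∈ Matrix.unitaryGroup (Fin N) ℂ) {φ : Additive G → ℝ}
    (hφ0 : φ 0 = 1) (hφ : ∀ a, 0 ≤ φ a) {ε : ℝ} (hε0 : 0 ≤ ε) (hε : ∀ a, a ≠ 0 → φ a ≤ ε) :
    ∑ η ∈ Img 4 8 G, Wt φ η *
        (((N : ℝ) - (ρ (Additive.toMul (η ((0 : Site 4 8), ⟨(0, 1), h01⟩)))).trace.re) *
          ((N : ℝ) - (ρ (Additive.toMul (η ((te 2 : Site 4 8), ⟨(0, 1), h01⟩)))).trace.re)) ≤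
      4 * (N : ℝ) ^ 2 * ((∑ η ∈ Closed 4 8 (Additive G), Wt φ η) *
        (peierlsSum 4 8 (Fintype.card (Additive G) * ε) 8 +
          peierlsSum 4 8 (Fintype.card (Additive G) * ε) 5 ^ 2)) := by
  classical
  have hN : (0 : ℝ) ≤ N := Nat.cast_nonneg N
  have h4N : (0 : ℝ) ≤ 4 * (N : ℝ) ^ 2 := by positivity
  refine le_trans (sum_Img_le_of_le_indicator hφ (M := 4 * (N : ℝ) ^ 2) h4N
    (fun η => η ((0 : Site 4 8), ⟨(0, 1), h01⟩) ≠ 0 ∧ η ((te 2 : Site 4 8), ⟨(0, 1), h01⟩) ≠ 0)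
    (fun η => ?_)) ?_
  · split_ifs with h
    · have h1 := gap_mem ρ hρu (Additive.toMul (η ((0 : Site 4 8), ⟨(0, 1), h01⟩)))
      have h2 := gap_mem ρ hρu (Additive.toMul (η ((te 2 : Site 4 8), ⟨(0, 1), h01⟩)))
      nlinarith
    · rcases not_and_or.1 h with h | h <;> push Not at h <;> rw [h, toMul_zero, gap_one] <;> simp
  · exact mul_le_mul_of_nonneg_left (sum_closed_p0p1_le hφ0 hφ hε0 hε) h4N

/-- One-plaquette upper bound through a vortex-size lemma at the plaquette `q`. -/
theorem sum_Img_one_le (hρu : ∀ g, ρ g ∈ Matrix.unitaryGroup (Fin N) ℂ) {φ : Additive G → ℝ}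
    (hφ0 : φ 0 = 1) (hφ : ∀ a, 0 ≤ φ a) {ε : ℝ} (hε0 : 0 ≤ ε) (hε : ∀ a, a ≠ 0 → φ a ≤ ε)
    (q : Plaquette 4 8)
    (hq : ∀ η : Plaquette 4 8 → Additive G, IsClosedPl η → η q ≠ 0 →
      5 ≤ (rcomponent CubeAdj (psupp η) q).card) :
    ∑ η ∈ Img 4 8 G, Wt φ η * ((N : ℝ) - (ρ (Additive.toMul (η q))).trace.re) ≤
      2 * (N : ℝ) * ((∑ η ∈ Closed 4 8 (Additive G), Wt φ η) *
        peierlsSum 4 8 (Fintype.card (Additive G) * ε) 5) := by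
  classical
  have hN : (0 : ℝ) ≤ N := Nat.cast_nonneg N
  obtain ⟨T, hTmem, hbig5⟩ : ∃ T : Finset (Plaquette 4 8 → Additive G),
      (∀ η : Plaquette 4 8 → Additive G, IsClosedPl η →
        (∃ C ∈ rcomponents CubeAdj (psupp η), 5 ≤ C.card) → η ∈ T) ∧
      ∑ η ∈ T, Wt φ η ≤ (∑ η ∈ Closed 4 8 (Additive G), Wt φ η) *
        peierlsSum 4 8 (Fintype.card (Additive G) * ε) 5 :=
    ⟨_, fun η hcl hC => Finset.mem_filter.2 ⟨mem_Closed.2 hcl, hC⟩,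
      sum_closed_bigComponent_le (d := 4) (L := 8) (A := Additive G) hφ0 hφ hε0 hε 5⟩
  have h2N : (0 : ℝ) ≤ 2 * (N : ℝ) := by positivity
  refine le_trans (sum_Img_le_of_le_indicator hφ (M := 2 * (N : ℝ)) h2N (fun η => η q ≠ 0)
    (fun η => ?_)) (mul_le_mul_of_nonneg_left ?_ h2N)
  · split_ifs with h
    · exact (gap_mem ρ hρu _).2
    · push Not at h; rw [h, toMul_zero, gap_one]
  · refine le_trans (Finset.sum_le_sum_of_subset_of_nonneg (fun η hη => ?_)
      (fun η _ _ => Wt_nonneg hφ η)) hbig5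
    obtain ⟨hcl, hne⟩ := Finset.mem_filter.1 hη
    exact hTmem η (mem_Closed.1 hcl) ⟨_, mem_rcomponents_iff.2 ⟨q, mem_psupp.2 hne, rfl⟩,
      hq η (mem_Closed.1 hcl) hne⟩

/-- **`q₀ = (0; 0,2)`, upper bound.** -/
theorem sum_Img_q0_le (hρu : ∀ g, ρ g ∈ Matrix.unitaryGroup (Fin N) ℂ) {φ : Additive G → ℝ}
    (hφ0 : φ 0 = 1) (hφ : ∀ a, 0 ≤ φ a) {ε : ℝ} (hε0 : 0 ≤ ε) (hε : ∀ a, a ≠ 0 → φ a ≤ ε) :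
    ∑ η ∈ Img 4 8 G, Wt φ η *
        ((N : ℝ) - (ρ (Additive.toMul (η ((0 : Site 4 8), ⟨(0, 2), h02⟩)))).trace.re) ≤
      2 * (N : ℝ) * ((∑ η ∈ Closed 4 8 (Additive G), Wt φ η) *
        peierlsSum 4 8 (Fintype.card (Additive G) * ε) 5) :=
  sum_Img_one_le ρ hρu hφ0 hφ hε0 hε _ fun _ hcl hne => five_le_card_rcomponent_q0 hcl hne

/-- **`p₁ = (e₂; 0,1)`, upper bound.** -/
theorem sum_Img_p1_le (hρu : ∀ g, ρ g ∈ Matrix.unitaryGroup (Fin N) ℂ) {φ : Additive G → ℝ}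
    (hφ0 : φ 0 = 1) (hφ : ∀ a, 0 ≤ φ a) {ε : ℝ} (hε0 : 0 ≤ ε) (hε : ∀ a, a ≠ 0 → φ a ≤ ε) :
    ∑ η ∈ Img 4 8 G, Wt φ η *
        ((N : ℝ) - (ρ (Additive.toMul (η ((te 2 : Site 4 8), ⟨(0, 1), h01⟩)))).trace.re) ≤
      2 * (N : ℝ) * ((∑ η ∈ Closed 4 8 (Additive G), Wt φ η) *
        peierlsSum 4 8 (Fintype.card (Additive G) * ε) 5) :=
  sum_Img_one_le ρ hρu hφ0 hφ hε0 hε _ fun _ hcl hne => five_le_card_rcomponent_p1 hcl hne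

/-! ### The single-link excitation `U = 1[(e₂,0) ↦ g₀]` -/

omit [Fintype G] [DecidableEq G] in
/-- The holonomies of the single-link excitation: trivial, or `g₀^{±1}` on one of the six
plaquettes through the link `(e₂, 0)`. -/
theorem holonomy_update_cases (g₀ : G) (x : Site 4 8) {i j : Fin 4} (hij : i < j) :
    plaquetteHolonomy (Function.update (1 : GaugeConfig 4 8 G) ((te 2 : Site 4 8), (0 : Fin 4)) g₀)
        x i j = 1 ∨
      ((plaquetteHolonomy (Function.update (1 : GaugeConfig 4 8 G) ((te 2 : Site 4 8), (0 : Fin 4))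
            g₀) x i j = g₀ ∨
          plaquetteHolonomy (Function.update (1 : GaugeConfig 4 8 G) ((te 2 : Site 4 8), (0 : Fin 4))
            g₀) x i j = g₀⁻¹) ∧
        (x, (⟨(i, j), hij⟩ : {p : Fin 4 × Fin 4 // p.1 < p.2})) ∈
          ({((te 2 : Site 4 8), ⟨(0, 1), h01⟩), ((te 2 : Site 4 8), ⟨(0, 2), h02⟩),
            ((te 2 : Site 4 8), ⟨(0, 3), h03⟩), ((te 2 : Site 4 8) - te 1, ⟨(0, 1), h01⟩),
            ((te 2 : Site 4 8) - te 2, ⟨(0, 2), h02⟩), ((te 2 : Site 4 8) - te 3, ⟨(0, 3), h03⟩)} :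
            Finset (Plaquette 4 8))) := by
  have hj0 : j ≠ 0 := fun h => by subst h; exact absurd hij (Fin.not_lt_zero i) 
  -- the four link values
  have e2 : Function.update (1 : GaugeConfig 4 8 G) ((te 2 : Site 4 8), (0 : Fin 4)) g₀
      (x.shift i, j) = 1 := by
    rw [Function.update_of_ne (fun h => hj0 (congrArg Prod.snd h)), Pi.one_apply]
  have e4 : Function.update (1 : GaugeConfig 4 8 G) ((te 2 : Site 4 8), (0 : Fin 4)) g₀
      (x, j) = 1 := by
    rw [Function.update_of_ne (fun h => hj0 (congrArg Prod.snd h)), Pi.one_apply]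
  unfold plaquetteHolonomy
  rw [e2, e4, mul_one, inv_one, mul_one]
  by_cases c1 : (x, i) = ((te 2 : Site 4 8), (0 : Fin 4))
  · by_cases c3 : (x.shift j, i) = ((te 2 : Site 4 8), (0 : Fin 4))
    · exfalso
      have h1 : x = te 2 := congrArg Prod.fst c1
      have h3 : x.shift j = te 2 := congrArg Prod.fst c3
      rw [Site.shift, h1] at h3
      have := congrFun h3 j
      simp at this
      exact absurd this (by decide)
    · rw [c1, Function.update_self, Function.update_of_ne c3]
      simp only [Pi.one_apply, inv_one, mul_one]
      refine Or.inr ⟨Or.inl trivial, ?_⟩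
      obtain ⟨hx, hi⟩ := Prod.ext_iff.1 c1
      simp only at hx hi
      subst hx; subst hi
      fin_cases j
      · exact absurd hij (by decide)
      all_goals simp
  · by_cases c3 : (x.shift j, i) = ((te 2 : Site 4 8), (0 : Fin 4))
    · rw [Function.update_of_ne c1, c3, Function.update_self]
      simp only [Pi.one_apply, one_mul]
      refine Or.inr ⟨Or.inr trivial, ?_⟩
      obtain ⟨hx, hi⟩ := Prod.ext_iff.1 c3
      simp only at hx hi
      subst hi
      have hx' : x = te 2 - te j := eq_sub_of_add_eq hx
      subst hx'
      fin_cases j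
      · exact absurd hij (by decide)
      all_goals simp
    · rw [Function.update_of_ne c1, Function.update_of_ne c3]
      simp only [Pi.one_apply, inv_one, mul_one]
      exact Or.inl trivial

/-- **Shared-link pair, lower bound**: for every `g₀` and `β ≥ 0`,
`∑_{η exact} Wt_β(η) P(η q₀) P(η p₁) ≥ P(g₀)² e^{-6βP(g₀)}` (`P(g) = N - Re tr ρ(g)`). -/
theorem sum_Img_pair_ge (hρu : ∀ g, ρ g ∈ Matrix.unitaryGroup (Fin N) ℂ) {β : ℝ} (hβ : 0 ≤ β)
    (g₀ : G) :
    ((N : ℝ) - (ρ g₀).trace.re) ^ 2 * Real.exp (-(β * ((N : ℝ) - (ρ g₀).trace.re))) ^ 6 ≤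
      ∑ η ∈ Img 4 8 G, Wt (wilsonPhi ρ β) η *
        (((N : ℝ) - (ρ (Additive.toMul (η ((0 : Site 4 8), ⟨(0, 2), h02⟩)))).trace.re) *
          ((N : ℝ) - (ρ (Additive.toMul (η ((te 2 : Site 4 8), ⟨(0, 1), h01⟩)))).trace.re)) := by
  classical
  set U : GaugeConfig 4 8 G :=
    Function.update (1 : GaugeConfig 4 8 G) ((te 2 : Site 4 8), (0 : Fin 4)) g₀ with hU
  set δ : ℝ := (N : ℝ) - (ρ g₀).trace.re with hδ
  have hδ0 : 0 ≤ δ := (gap_mem ρ hρu g₀).1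
  have hδinv : (N : ℝ) - (ρ g₀⁻¹).trace.re = δ := by rw [re_trace_map_inv ρ hρu]
  -- every term is non-negative
  have hterm : ∀ η ∈ Img 4 8 G, 0 ≤ Wt (wilsonPhi ρ β) η *
      (((N : ℝ) - (ρ (Additive.toMul (η ((0 : Site 4 8), ⟨(0, 2), h02⟩)))).trace.re) *
        ((N : ℝ) - (ρ (Additive.toMul (η ((te 2 : Site 4 8), ⟨(0, 1), h01⟩)))).trace.re)) :=
    fun η _ => mul_nonneg (Wt_nonneg (wilsonPhi_nonneg ρ β) η)
      (mul_nonneg (gap_mem ρ hρu _).1 (gap_mem ρ hρu _).1)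
  refine le_trans ?_ (Finset.single_le_sum hterm (plaqField_mem_Img U))
  -- the two plaquette values of `U`
  have hq0 : plaquetteHolonomy U (0 : Site 4 8) 0 2 = g₀⁻¹ := by
    have u1 : U ((0 : Site 4 8), (0 : Fin 4)) = 1 := by
      rw [hU, Function.update_of_ne (by decide), Pi.one_apply]
    have u2 : U ((0 : Site 4 8).shift 0, (2 : Fin 4)) = 1 := by
      rw [hU, Function.update_of_ne (by decide), Pi.one_apply]
    have u3 : U ((0 : Site 4 8).shift 2, (0 : Fin 4)) = g₀ := by
      rw [hU, show ((0 : Site 4 8).shift 2, (0 : Fin 4)) = ((te 2 : Site 4 8), (0 : Fin 4)) from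
        by decide, Function.update_self]
    have u4 : U ((0 : Site 4 8), (2 : Fin 4)) = 1 := by
      rw [hU, Function.update_of_ne (by decide), Pi.one_apply]
    rw [plaquetteHolonomy, u1, u2, u3, u4]; group
  have hp1 : plaquetteHolonomy U (te 2 : Site 4 8) 0 1 = g₀ := by
    have u1 : U ((te 2 : Site 4 8), (0 : Fin 4)) = g₀ := by rw [hU, Function.update_self]
    have u2 : U ((te 2 : Site 4 8).shift 0, (1 : Fin 4)) = 1 := by
      rw [hU, Function.update_of_ne (by decide), Pi.one_apply]
    have u3 : U ((te 2 : Site 4 8).shift 1, (0 : Fin 4)) = 1 := by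
      rw [hU, Function.update_of_ne (by decide), Pi.one_apply]
    have u4 : U ((te 2 : Site 4 8), (1 : Fin 4)) = 1 := by
      rw [hU, Function.update_of_ne (by decide), Pi.one_apply]
    rw [plaquetteHolonomy, u1, u2, u3, u4]; group
  have hvq0 : (N : ℝ) - (ρ (Additive.toMul (plaqField U ((0 : Site 4 8), ⟨(0, 2), h02⟩)))).trace.re
      = δ := by
    rw [plaqField_apply, toMul_ofMul]; exact hq0 ▸ hδinv
  have hvp1 : (N : ℝ) - (ρ (Additive.toMul (plaqField U ((te 2 : Site 4 8), ⟨(0, 1), h01⟩)))).trace.re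
      = δ := by
    rw [plaqField_apply, toMul_ofMul]; exact hp1 ▸ rfl
  rw [hvq0, hvp1]
  -- the weight of `U`: supported on at most six plaquettes, each factor `≥ e^{-βδ}`
  have hsupp : psupp (plaqField U) ⊆
      ({((te 2 : Site 4 8), ⟨(0, 1), h01⟩), ((te 2 : Site 4 8), ⟨(0, 2), h02⟩),
        ((te 2 : Site 4 8), ⟨(0, 3), h03⟩), ((te 2 : Site 4 8) - te 1, ⟨(0, 1), h01⟩),
        ((te 2 : Site 4 8) - te 2, ⟨(0, 2), h02⟩), ((te 2 : Site 4 8) - te 3, ⟨(0, 3), h03⟩)} :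
        Finset (Plaquette 4 8)) := by
    rintro ⟨x, ⟨⟨i, j⟩, hij⟩⟩ hp
    rw [mem_psupp, plaqField_apply, Ne, ofMul_eq_zero] at hp
    rcases holonomy_update_cases g₀ x hij with h | ⟨-, hmem⟩
    · exact absurd h hp
    · exact hmem
  have hcard : (psupp (plaqField U)).card ≤ 6 :=
    (Finset.card_le_card hsupp).trans (Finset.card_le_six)
  have hfac : ∀ p ∈ psupp (plaqField U), Real.exp (-(β * δ)) ≤ wilsonPhi ρ β (plaqField U p) := by
    rintro ⟨x, ⟨⟨i, j⟩, hij⟩⟩ _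
    rw [wilsonPhi, plaqField_apply, toMul_ofMul]
    refine Real.exp_le_exp.2 ?_
    rcases holonomy_update_cases g₀ x hij with h | ⟨h | h, -⟩
    · simp only at h; rw [h, gap_one]; nlinarith
    · simp only at h; rw [h]; nlinarith
    · simp only at h; rw [h, hδinv]; nlinarith
  have hε1 : Real.exp (-(β * δ)) ≤ 1 := Real.exp_le_one_iff.2 (by nlinarith)
  have hε0 : 0 ≤ Real.exp (-(β * δ)) := (Real.exp_pos _).le
  calc δ ^ 2 * Real.exp (-(β * δ)) ^ 6 ≤ δ ^ 2 * Real.exp (-(β * δ)) ^ (psupp (plaqField U)).card :=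
        mul_le_mul_of_nonneg_left (pow_le_pow_of_le_one hε0 hε1 hcard) (sq_nonneg _)
    _ = δ ^ 2 * ∏ _p ∈ psupp (plaqField U), Real.exp (-(β * δ)) := by rw [Finset.prod_const]
    _ ≤ δ ^ 2 * ∏ p ∈ psupp (plaqField U), wilsonPhi ρ β (plaqField U p) :=
        mul_le_mul_of_nonneg_left (Finset.prod_le_prod (fun _ _ => hε0) hfac) (sq_nonneg _)
    _ = Wt (wilsonPhi ρ β) (plaqField U) * (δ * δ) := by
        rw [← Wt_eq_prod_psupp (wilsonPhi_zero ρ β)]; ring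

end L8

end Summit.QuantumFields.YangMills.Theorems.FemtoCurvatureTwoPoint.Negative.FiniteGroupBounds

end
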